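import Summits.BirchSwinnertonDyer.BirchSwinnertonDyer.Theorems.GenusKolyvaginAtTwoEquivariantKolyvaginExactAtTwoSelmerDescentSplit
import Summits.BirchSwinnertonDyer.BirchSwinnertonDyer.Theorems.GenusKolyvaginAtTwoEquivariantKolyvaginExactAtTwoLocalDualityOrder
import Summits.BirchSwinnertonDyer.BirchSwinnertonDyer.Theorems.GenusKolyvaginAtTwoEquivariantKolyvaginExactAtTwoTwistLocalConditions
import HarnessLib

/-!
# Route `GenusKolyvaginAtTwo`, LINE 6, KEY crux Q3 (inner statement of stmt-BirchSwinnertonDyer-22137):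
# the Selmer local condition descends `K → ℚ` along a quadratic extension at ANY odd place without local
# `2`-torsion — McCallum's Lemma 4.3 over `ℚ` at the RAMIFIED primes `v ∣ d_K` for BOTH members of the pair
# `(E, E^{(d_K)})`, on the DEF-free habitat in ARITHMETIC form

Helper (seat `bsd-line-gk2-p3` g13; `--supports` the crux, closes nothing). The residual ℚ-hypotheses of the
pair instance (`…VisiblePairInputReductions(Split)`, p640947/p642024) after this lineage's transfers
(`…SelmerDescentUnramified/Quadratic/Ramified/Split`) were: `v = 2` inert, the DEF primes `v ∣ d_K` for the member
`E` (Galois-form hypothesis `hfix` of `…SelmerDescentRamified`: good reduction, `v ∤ n`), and `v ∣ d_K` for the twin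
`E^{(d_K)}` (ADDITIVE there — no transfer available so far). This file gives a second, hypothesis-light transfer
which needs neither good reduction nor `v ∤ n` nor any Galois-theoretic input, and covers both members at once:

* §1 (any `L/F` with `[L : F] ≤ 2`, any `W/F` elliptic, any `n`, any finite place `v ∤ 2` of `F`, `w ∣ v`):
  `mem_selmerLocalKer_of_resTorsion_mem_of_natCard_two_torsion_eq_one` — **if `E(F_v)[2] = 0` then
  `res x ∈ selmerLocalKer_w(E_L) ⟹ x ∈ selmerLocalKer_v(E)`.** Proof: the localisation `z ∈ H¹(F_v, E)` of the
  image of `x` in `H¹(F, E)` dies over `L_w`, so `2z = 0` (`two_nsmul_mem_localRestrictionKer_of_tower`,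
  `[L_w : F_v] ≤ [L : F] ≤ 2`); and `#H¹(F_v, E)[2] = #E(F_v)[2] = 1` UNCONDITIONALLY off `2` (Tate local duality,
  order form: this lineage's `LocalDualityOrder.natCard_torsionBy_localH1_eq_of_not_mem`, Milne I Thm. 3.2 with
  Lemma 3.3), so `z = 0`.
* §2 (over `ℚ`, `K` quadratic): `mem_selmerLocalKer_of_K_of_natCard_two_torsion_eq_one` (member `E`, from the
  `K`-level condition of `c_K = res u` at the places above `v`) and
  `mem_selmerLocalKer_twin_of_K_of_natCard_two_torsion_eq_one` (member `E^{(c')}`, through `hPsiKT`).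
* §3 `two_notMem_of_odd_of_mem` — a prime of `ℤ` containing an odd integer does not contain `2` (so the primes
  `v ∣ d_K`, `d_K` odd, are odd places and §2 applies there).

Reading for the crux (pair descent at `2` over `ℚ`, `n = 2^M`): at a prime `v ∣ d_K` the hypothesis `E(ℚ_v)[2] = 0`
(`Frob_v` a `3`-cycle on `E[2]`, `a_v(E)` odd — the DEF-FREE primes of memo Q3-RAT-LOCAL §6–§7, evidence #34) is
the ARITHMETIC form of the DEF-free condition; since `E^{(d_K)}[2] ≅ E[2]` as Galois modules, the same condition
reads `E^{(d_K)}(ℚ_v)[2] = 0` for the twin. So Lemma 4.3 over `ℚ` at the primes of `d_K` follows from Lemma 4.3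
over `K` for BOTH members on the DEF-free habitat, with no hypothesis on the reduction (the twin is additive there)
and at every level `n`. THEOREMS ONLY (no definition, no named fact, no `sorry`, standard axioms). BSD is not proved
by any of this.

References: [McCallumLMS1991] §4 Lemma 4.3; [MilneADT2006] I Thm. 3.2, Lemma 3.3, Cor. 3.4;
[SerreGaloisCohomology1997] I §2.4 (Cor. to Prop. 9); [Kolyvagin1989Izv] §3 (the pair `(E, E^D)`, criterion
`B_2(E, D)`); [GrossLMS1991] Prop. 6.2 (1).
-/

set_option autoImplicit false
set_option linter.dupNamespace false -- tree convention: `Summit.BirchSwinnertonDyer.BirchSwinnertonDyer.Theorems` (summit = sub-problem)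

noncomputable section

open scoped Classical

universe u

namespace Summit.BirchSwinnertonDyer.BirchSwinnertonDyer.Theorems.GenusExact.SelmerDescent

open WeierstrassCurve NumberField IsDedekindDomain Field
open Literature.NumberTheory.EllipticCurves Literature.NumberTheory.GaloisRepresentations
open Summit.BirchSwinnertonDyer.BirchSwinnertonDyer.Theorems.GenusExact.LocalDualityOrder
open Summit.BirchSwinnertonDyer.BirchSwinnertonDyer.Theorems.GenusExact.EigenClassesFinite

/-! ## §1 Extensions of degree `≤ 2`: the transfer at an odd place without local `2`-torsion -/

section General

variable {F : Type u} [Field F] [NumberField F] (W : WeierstrassCurve F) [W.IsElliptic]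
variable (L : Type u) [Field L] [NumberField L] [Algebra F L]
variable (v : HeightOneSpectrum (𝓞 F)) (w : HeightOneSpectrum (𝓞 L)) [w.asIdeal.LiesOver v.asIdeal]

/-- **A local class killed by `2` vanishes at an odd place without local `2`-torsion.** For `E = W/F` elliptic,
`v ∤ 2` a finite place with `E(F_v)[2] = 0` and `z ∈ H¹(F_v, E)`: `2z = 0 ⟹ z = 0`, since
`#H¹(F_v, E)[2] = #E(F_v)[2]` unconditionally off `2` (Tate local duality, order form). [cite: MilneADT2006, I Thm. 3.2 and Lemma 3.3] -/
theorem localH1_eq_zero_of_two_nsmul_eq_zero_of_natCard_two_torsion_eq_one (h2v : (2 : 𝓞 F) ∉ v.asIdeal)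
    (htors : Nat.card (nsmulAddMonoidHom 2 :
      (W.baseChange (v.adicCompletion F)).toAffine.Point →+ _).ker = 1)
    {z : W.localH1 (v.adicCompletion F)} (hz : 2 • z = 0) : z = 0 := by
  haveI : Fact (Nat.Prime 2) := ⟨Nat.prime_two⟩
  have h2v' : ((2 : ℕ) : 𝓞 F) ∉ v.asIdeal := by rwa [Nat.cast_ofNat]
  have hcard := natCard_torsionBy_localH1_eq_of_not_mem v W (p := 2) (k := 1) one_ne_zero h2v'
  rw [pow_one, htors] at hcard
  -- `H¹(F_v, E)[2]` is trivial; `galoisCohomology (localGaloisModule F_v) 1 = localH1 F_v` definitionally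
  have key : ∀ z' : galoisCohomology (W.localGaloisModule (v.adicCompletion F)) 1, 2 • z' = 0 → z' = 0 := by
    intro z' hz'
    have hmem : z' ∈ AddSubgroup.torsionBy
        (galoisCohomology (W.localGaloisModule (v.adicCompletion F)) 1) ((2 ^ 1 : ℕ) : ℤ) := by
      rw [AddSubgroup.torsionBy.nsmul_iff, pow_one]
      exact hz'
    haveI := (Nat.card_eq_one_iff_unique.mp hcard).1
    exact congrArg Subtype.val (Subsingleton.elim (⟨z', hmem⟩ : AddSubgroup.torsionBy
      (galoisCohomology (W.localGaloisModule (v.adicCompletion F)) 1) ((2 ^ 1 : ℕ) : ℤ)) ⟨0, zero_mem _⟩)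
  exact key z hz

omit [W.IsElliptic] in
/-- **Along `[L : F] ≤ 2`, a global class dying over `L_w` is killed by `2` over `F_v`**: for `c ∈ H¹(F, E)` with
`c ∈ localRestrictionKer_{L_w}`, `2c ∈ localRestrictionKer_{F_v}` (`[L_w : F_v] ≤ [L : F] ≤ 2` and the index kills the
kernel of restriction). [cite: SerreGaloisCohomology1997, I §2.4 (Cor. to Prop. 9)] -/
theorem two_nsmul_mem_localRestrictionKer_of_finrank_le_two (h2 : Module.finrank F L ≤ 2) {c : W.galH1}
    (hc : letI : Algebra (v.adicCompletion F) (w.adicCompletion L) :=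
        (adicCompletionMap (K := F) L v w).toAlgebra
      c ∈ W.localRestrictionKer (w.adicCompletion L)) :
    2 • c ∈ W.localRestrictionKer (v.adicCompletion F) := by
  letI : Algebra (v.adicCompletion F) (w.adicCompletion L) := (adicCompletionMap (K := F) L v w).toAlgebra
  obtain ⟨hfin, hle⟩ := finrank_adicCompletion_le_of_liesOver L v w
  haveI : FiniteDimensional (v.adicCompletion F) (w.adicCompletion L) := hfin
  haveI : IsScalarTower F (v.adicCompletion F) (w.adicCompletion L) :=
    IsScalarTower.of_algebraMap_eq fun x ↦ (adicCompletionMap_coe (K := F) L v w x).symm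
  haveI : CharZero (v.adicCompletion F) :=
    charZero_of_injective_algebraMap (algebraMap F (v.adicCompletion F)).injective
  exact two_nsmul_mem_localRestrictionKer_of_tower W (E := v.adicCompletion F) (hle.trans h2) hc

/-- **The Selmer condition descends along `[L : F] ≤ 2` at an odd place without local `2`-torsion.** Let
`E = W/F` be elliptic, `[L : F] ≤ 2`, `n : ℤ`, `v ∤ 2` a finite place of `F` with `E(F_v)[2] = 0`, `w ∣ v`. For
`x ∈ H¹(F, E[n])`: if `res x` satisfies the Selmer condition of `E_L` at `w`, then `x` satisfies the Selmer condition
of `E` at `v` — with NO hypothesis on the reduction of `E` at `v` nor on `v ∤ n`. (The image `z` of `x` in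
`H¹(F_v, E)` dies over `L_w`, so `2z = 0`; and `H¹(F_v, E)[2] = 0`.) [cite: McCallumLMS1991, §4 Lemma 4.3]
[cite: MilneADT2006, I Thm. 3.2] -/
theorem mem_selmerLocalKer_of_resTorsion_mem_of_natCard_two_torsion_eq_one (h2 : Module.finrank F L ≤ 2)
    (n : ℤ) (h2v : (2 : 𝓞 F) ∉ v.asIdeal)
    (htors : Nat.card (nsmulAddMonoidHom 2 :
      (W.baseChange (v.adicCompletion F)).toAffine.Point →+ _).ker = 1)
    {x : galH1Torsion W n}
    (hx : resTorsion W L n x ∈ selmerLocalKer (W.baseChange L) (w.adicCompletion L) n) :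
    x ∈ selmerLocalKer W (v.adicCompletion F) n := by
  letI : Algebra (v.adicCompletion F) (w.adicCompletion L) := (adicCompletionMap (K := F) L v w).toAlgebra
  haveI : IsScalarTower F (v.adicCompletion F) (w.adicCompletion L) :=
    IsScalarTower.of_algebraMap_eq fun x ↦ (adicCompletionMap_coe (K := F) L v w x).symm
  rw [mem_selmerLocalKer_iff_torsionH1ToH1_mem]
  rw [mem_selmerLocalKer_iff_torsionH1ToH1_mem, torsionH1ToH1_resTorsion] at hx
  have hx' : torsionH1ToH1 W n x ∈ W.localRestrictionKer (w.adicCompletion L) :=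
    (mem_localRestrictionKer_iff_resBaseChange_mem W _).mpr hx
  have h2c := two_nsmul_mem_localRestrictionKer_of_finrank_le_two W L v w h2 hx'
  rw [localRestrictionKer_eq_ker, AddMonoidHom.mem_ker, map_nsmul] at h2c
  rw [localRestrictionKer_eq_ker, AddMonoidHom.mem_ker]
  exact localH1_eq_zero_of_two_nsmul_eq_zero_of_natCard_two_torsion_eq_one W v h2v htors h2c

end General

/-! ## §2 Over `ℚ` with `K` quadratic: member `E` and member `E^{(c')}` -/

section Rat

variable {K : Type} [Field K] [NumberField K] (W : WeierstrassCurve ℚ) [W.IsElliptic]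

/-- **Member `E`, one odd place without local `2`-torsion** (`K/ℚ` quadratic; any reduction, any `n`): the ℚ-level
Selmer condition of `u` at `v` from the `K`-level condition of `c_K = res u` at the places above `v`. For the pair
descent of LINE 6 at a prime `v ∣ d_K`: Lemma 4.3 over `ℚ` for `E` from Lemma 4.3 over `K`, under the DEF-free
condition `E(ℚ_v)[2] = 0` in arithmetic form. [cite: McCallumLMS1991, §4 Lemma 4.3] [cite: Kolyvagin1989Izv, §3] -/
theorem mem_selmerLocalKer_of_K_of_natCard_two_torsion_eq_one (h2 : Module.finrank ℚ K = 2) (n : ℤ)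
    {u : galH1Torsion W n} {cK : galH1Torsion (W.baseChange K) n} (hu : resTorsion W K n u = cK)
    (v : HeightOneSpectrum (𝓞 ℚ)) (h2v : (2 : 𝓞 ℚ) ∉ v.asIdeal)
    (htors : Nat.card (nsmulAddMonoidHom 2 :
      (W.baseChange (v.adicCompletion ℚ)).toAffine.Point →+ _).ker = 1)
    (hK : ∀ (w : HeightOneSpectrum (𝓞 K)) [w.asIdeal.LiesOver v.asIdeal],
      cK ∈ selmerLocalKer (W.baseChange K) (w.adicCompletion K) n) :
    u ∈ selmerLocalKer W (v.adicCompletion ℚ) n := by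
  obtain ⟨w, hw⟩ := exists_liesOver K v
  exact mem_selmerLocalKer_of_resTorsion_mem_of_natCard_two_torsion_eq_one W K v w h2.le n h2v htors
    (hu ▸ hK w)

omit [W.IsElliptic] in
/-- **Member `E^{(c')}`, one odd place without local `2`-torsion of the twist** (`K = ℚ(θ)` quadratic,
`θ² = c'`; any reduction — in particular ADDITIVE, `v ∣ c'` —, any `n`): the ℚ-level Selmer condition of `y` at
`v` from the `K`-level condition of `c_K = hPsiKT (res y)` at the places above `v` (`hPsiKT` respects the Selmer
condition, `…TwistLocalConditions`). For the pair descent of LINE 6 at `v ∣ d_K`: Lemma 4.3 over `ℚ` for the twin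
`E^{(d_K)}` from Lemma 4.3 over `K`, under `E^{(d_K)}(ℚ_v)[2] = 0` (`= E(ℚ_v)[2]`, the DEF-free condition).
[cite: McCallumLMS1991, §4 Lemma 4.3] [cite: SilvermanAEC2009, X.5 Cor. 5.4] [cite: Kolyvagin1989Izv, §3] -/
theorem mem_selmerLocalKer_twin_of_K_of_natCard_two_torsion_eq_one (h2 : Module.finrank ℚ K = 2)
    {θ : K} {c' : ℚ} (hθ : θ ∉ Set.range (algebraMap ℚ K)) (hc : θ ^ 2 = algebraMap ℚ K c')
    [(W.quadraticTwist c').IsElliptic] (n : ℤ) {y : galH1Torsion (W.quadraticTwist c') n}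
    {cK : galH1Torsion (W.baseChange K) n}
    (hy : hPsiKT W K hθ hc n (resTorsion (W.quadraticTwist c') K n y) = cK) (v : HeightOneSpectrum (𝓞 ℚ))
    (h2v : (2 : 𝓞 ℚ) ∉ v.asIdeal)
    (htors : Nat.card (nsmulAddMonoidHom 2 :
      ((W.quadraticTwist c').baseChange (v.adicCompletion ℚ)).toAffine.Point →+ _).ker = 1)
    (hK : ∀ (w : HeightOneSpectrum (𝓞 K)) [w.asIdeal.LiesOver v.asIdeal],
      cK ∈ selmerLocalKer (W.baseChange K) (w.adicCompletion K) n) :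
    y ∈ selmerLocalKer (W.quadraticTwist c') (v.adicCompletion ℚ) n := by
  obtain ⟨w, hw⟩ := exists_liesOver K v
  have hx : resTorsion (W.quadraticTwist c') K n y ∈
      selmerLocalKer ((W.quadraticTwist c').baseChange K) (w.adicCompletion K) n := by
    rw [mem_selmerLocalKer_iff_hPsiKT_mem W K hθ hc n (w.adicCompletion K), hy]
    exact hK w
  exact mem_selmerLocalKer_of_resTorsion_mem_of_natCard_two_torsion_eq_one (W.quadraticTwist c') K v w h2.le
    n h2v htors hx

/-! ## §3 The primes of an odd integer are odd places -/

omit [NumberField K] in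
/-- **A prime of `𝓞 F` containing an odd integer does not contain `2`** (else it contains `1`). For the pair
descent: the primes `v ∣ d_K` (`d_K` odd) are odd places. [folklore] -/
theorem two_notMem_of_odd_of_mem {F : Type*} [Field F] (v : HeightOneSpectrum (𝓞 F)) {d : ℤ} (hd : Odd d)
    (hdv : ((d : ℤ) : 𝓞 F) ∈ v.asIdeal) : (2 : 𝓞 F) ∉ v.asIdeal := by
  intro h2
  obtain ⟨k, rfl⟩ := hd
  apply v.isPrime.ne_top
  rw [Ideal.eq_top_iff_one]
  have h1 : ((2 * k + 1 : ℤ) : 𝓞 F) - 2 * (k : 𝓞 F) = 1 := by push_cast; ring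
  rw [← h1]
  exact v.asIdeal.sub_mem hdv (v.asIdeal.mul_mem_right _ h2)

end Rat

end Summit.BirchSwinnertonDyer.BirchSwinnertonDyer.Theorems.GenusExact.SelmerDescent

end
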